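import Summits.AtomisticToContinuum.Crystallization.Theorems.ChargedEnergyGapTiltConvex
import Summits.AtomisticToContinuum.Crystallization.Theorems.ChargedEnergyGapDualPriceStarA
import HarnessLib

/-!
# NODE 99 «CapCell» — the GENERIC second-order replay lemma for the CAP side of one census cell (lens-3 g90)

Line of record: `stmt-AtomisticToContinuum-14231` (`Summit.AtomisticToContinuum.ChargedEnergyGap`, route PricedLinkCensus r3), deciding
leaf (D¹) `SoloFeetLawQ 130 (1/60000000) 160 (3/100) (679/1000) (691/1000)`; census certificate schema CELLCERT v0.2 (frozen, r1619) +
the one-point amendment v0.2.1 (row kinds «env2» / «capenv2»).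

WHAT THIS FILE GIVES.  One theorem, `capCell_lower`, turning ~27 PURE-ARITHMETIC hypotheses (each a closed rational inequality the census
generator discharges by `norm_num [defs]`) into the cap minorant of a cell
  `∀ ρ ∈ [ρ₀, ρ₁], ∀ t ∈ [lo, hi], capLB · unit ≤ domCapK unit 160 (3/100) ρ t`.
Ingredients, all BY NAME: weak duality E6 at a dual-feasible price vector `y = sext y0T … y2F` (`domCapK_ge_of_dualFeasible`, NODE 93;
feasibility of y⋆ is NODE 96's `isRoofDualFeasible_T75_yStar`), the pole «env2» chord row (`depthProfile_chord_upper`, NODE 97), the three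
tilt «capenv2» secant rows (`tiltWeight_secant_lower`, NODE 98) with the anchor replacement rule over the ρ-cell (`tiltArg_le_box` /
`tiltArg_ge_box` / `depthProfile_sqrt_le/ge`, NODE 95), the box lemma `affine_ge_on_box` (an affine function of (t, ρ) is minorised on a
box by its smallest corner value) and `domKappa_ge_hi` (κ(t) ≥ κ(hi), so the κ-window factor of cells below t = 113 is kept).  Packaging: `CapCellGeom` (cell geometry), `PoleRowCert` (affine majorant `p₀ + p₁·d` of φ's chord on
[dlo, dhi] ⊇ {t − ρ}), `TiltRowCert c …` (anchor brackets rA/uA at `a`, rL/lL at `lo`, the NODE 98 side conditions 6400 ≤ q(a), q(hi) ≤ 17956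
at the ρ-corners, and an affine minorant `l₀ + l₁·t` of the majorised/minorised secant checked at t = lo, hi), `capMinorant` (the resulting
affine minorant of Σ_p y_p w_p(t, ρ)).  No `sorry`; axioms = the standard triple; every constant of the law enters only through the
hypotheses, so the same lemma serves every cell of the t ≥ 80 census band (worked instance = the ridge cell of the L5 «cap2» probe,
42.52 c_T, in the Audit file).
-/

noncomputable section
open scoped Classical
open Literature.MathematicalPhysics.StatisticalMechanics Literature.Geometry.DiscreteGeometry
open Summit.AtomisticToContinuum.Crystallization.Theses.PricedLinkCensus
open Summit.AtomisticToContinuum.Crystallization.Theorems.ChargedEnergyGapNegative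

namespace Summit.AtomisticToContinuum.Crystallization.Theorems.ChargedEnergyGapChartDial

/-! ## §99.1 Glue: affine functions on a box, the six components of `sext`, `κ(t) ≥ κ(hi)` -/

/-- ★ An affine function of `(x, y)` is bounded below on a box by the least of its four corner values. -/
theorem affine_ge_on_box {m p q r x₀ x₁ y₀ y₁ x y : ℝ}
    (h₀₀ : m ≤ p + q * x₀ + r * y₀) (h₀₁ : m ≤ p + q * x₀ + r * y₁) (h₁₀ : m ≤ p + q * x₁ + r * y₀) (h₁₁ : m ≤ p + q * x₁ + r * y₁)
    (hx₀ : x₀ ≤ x) (hx₁ : x ≤ x₁) (hy₀ : y₀ ≤ y) (hy₁ : y ≤ y₁) : m ≤ p + q * x + r * y := by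
  rcases le_total 0 q with hq | hq <;> rcases le_total 0 r with hr | hr
  · nlinarith [mul_le_mul_of_nonneg_left hx₀ hq, mul_le_mul_of_nonneg_left hy₀ hr]
  · nlinarith [mul_le_mul_of_nonneg_left hx₀ hq, mul_le_mul_of_nonpos_left hy₁ hr]
  · nlinarith [mul_le_mul_of_nonpos_left hx₁ hq, mul_le_mul_of_nonneg_left hy₀ hr]
  · nlinarith [mul_le_mul_of_nonpos_left hx₁ hq, mul_le_mul_of_nonpos_left hy₁ hr]

/-- ★ The six components of `sext`. -/
theorem sext_apply_six (a b c d e g : ℝ) :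
    sext a b c d e g (0, true) = a ∧ sext a b c d e g (0, false) = b ∧ sext a b c d e g (1, true) = c ∧
    sext a b c d e g (1, false) = d ∧ sext a b c d e g (2, true) = e ∧ sext a b c d e g (2, false) = g := by
  simp [sext]

/-- ★ `κ` is non-increasing: on a cell `t ≤ hi`, `κ(t) ≥ κ(hi) = max 1 (min 2 ((116 − hi)/3))` (a closed rational for the census). -/
theorem domKappa_ge_hi {t hi : ℝ} (h : t ≤ hi) : max 1 (min 2 ((116 - hi) / 3)) ≤ domKappa t := by
  unfold domKappa
  exact max_le_max le_rfl (min_le_min le_rfl (by linarith))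

/-! ## §99.2 The certificates (closed rational inequalities; the census discharges each by `norm_num [defs]`) -/

/-- ★ Cell geometry: `ρ ∈ [ρ₀, ρ₁]`, `t ∈ [lo, hi]`, tilt anchor `a ∈ [ρ₁, lo)`, pole interval `[dlo, dhi] ⊇ {t − ρ}` inside `[80, 134]`. -/
def CapCellGeom (ρ₀ ρ₁ a lo hi dlo dhi : ℝ) : Prop :=
  0 ≤ ρ₀ ∧ ρ₀ ≤ ρ₁ ∧ ρ₁ ≤ a ∧ a < lo ∧ lo < hi ∧ 80 ≤ dlo ∧ dlo < dhi ∧ dhi ≤ 134 ∧ dlo ≤ lo - ρ₁ ∧ hi - ρ₀ ≤ dhi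

/-- ★ Pole «env2» certificate: `p₀ + p₁·d` majorises `φ` at the two ends of `[dlo, dhi]` (hence its chord, hence `φ`, on the interval). -/
def PoleRowCert (dlo dhi p₀ p₁ : ℝ) : Prop :=
  depthProfile 160 dlo ≤ p₀ + p₁ * dlo ∧ depthProfile 160 dhi ≤ p₀ + p₁ * dhi

/-- ★ Tilt «capenv2» certificate for one constant `c` over the cell: anchor brackets (`q_c(·, a) ≤ rA²` at both ρ-corners, `φ(rA) ≤ uA`;
`rL² ≤` the ρ-tangent of `q_c(·, lo)` at both ρ-ends, `lL ≤ φ(rL)`), the NODE 98 side conditions (`6400 ≤ q_c(·, a)`, `q_c(·, hi) ≤ 17956`) at the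
ρ-corners, and an affine `l₀ + l₁·t` below the majorised/minorised secant at `t = lo` and `t = hi`. -/
def TiltRowCert (c ρ₀ ρ₁ a lo hi rA uA rL lL l₀ l₁ : ℝ) : Prop :=
  0 ≤ rA ∧ 0 ≤ rL ∧ tiltArg c ρ₀ a ≤ rA ^ 2 ∧ tiltArg c ρ₁ a ≤ rA ^ 2 ∧
  rL ^ 2 ≤ tiltArg c ρ₀ lo ∧ rL ^ 2 ≤ tiltArg c ρ₀ lo + (lo * (2 * c - 2) + 2 * ρ₀ * (3 - 2 * c)) * (ρ₁ - ρ₀) ∧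
  6400 ≤ tiltArg c ρ₀ a ∧ 6400 ≤ tiltArg c ρ₀ a + (a * (2 * c - 2) + 2 * ρ₀ * (3 - 2 * c)) * (ρ₁ - ρ₀) ∧
  tiltArg c ρ₀ hi ≤ 17956 ∧ tiltArg c ρ₁ hi ≤ 17956 ∧
  depthProfile 160 rA ≤ uA ∧ lL ≤ depthProfile 160 rL ∧
  l₀ + l₁ * lo ≤ lL ∧ l₀ + l₁ * hi ≤ uA * (1 - (hi - a) / (lo - a)) + lL * ((hi - a) / (lo - a))

/-- ★ The affine cap minorant of `Σ_p y_p w_p(t, ρ)` assembled from the row certificates (`y₀ = y0T + y0F ≤ 0` poles, `y₁, y₂ ≥ 0`, `y₃ = y2T + y2F ≥ 0`). -/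
def capMinorant (y₀ y₁ y₂ y₃ p₀ p₁ l₀₁ l₁₁ l₀₂ l₁₂ l₀₃ l₁₃ t ρ : ℝ) : ℝ :=
  y₀ * (p₀ + p₁ * (t - ρ)) + y₁ * (l₀₁ + l₁₁ * t) + y₂ * (l₀₂ + l₁₂ * t) + y₃ * (l₀₃ + l₁₃ * t)

/-! ## §99.3 The rows on a cell -/

/-- ★★ POLE ROW on a cell: `φ(d) ≤ p₀ + p₁·d` on `[dlo, dhi]` (chord of the convex `φ`, NODE 97, below the certified affine majorant). -/
theorem pole_row_cell {dlo dhi p₀ p₁ : ℝ} (hlo : 80 ≤ dlo) (hlt : dlo < dhi) (hhi : dhi ≤ 134) (hP : PoleRowCert dlo dhi p₀ p₁)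
    (d : ℝ) (hd₀ : dlo ≤ d) (hd₁ : d ≤ dhi) : depthProfile 160 d ≤ p₀ + p₁ * d := by
  obtain ⟨hPlo, hPhi⟩ := hP
  have hch := depthProfile_chord_upper hlo hhi hlt d hd₀ hd₁
  have hne : dhi - dlo ≠ 0 := (sub_pos.2 hlt).ne'
  have hμ₀ : 0 ≤ (d - dlo) / (dhi - dlo) := div_nonneg (by linarith) (by linarith)
  have hμ₁ : (d - dlo) / (dhi - dlo) ≤ 1 := by rw [div_le_one (by linarith)]; linarith
  have eμ : (d - dlo) / (dhi - dlo) * (dhi - dlo) = d - dlo := div_mul_cancel₀ _ hne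
  have e : (depthProfile 160 dhi - depthProfile 160 dlo) / (dhi - dlo) * (d - dlo) =
      (depthProfile 160 dhi - depthProfile 160 dlo) * ((d - dlo) / (dhi - dlo)) := by
    rw [div_mul_eq_mul_div, mul_div_assoc]
  rw [e] at hch
  have eμ' : p₁ * ((d - dlo) / (dhi - dlo) * (dhi - dlo)) = p₁ * (d - dlo) := by rw [eμ]
  nlinarith [mul_le_mul_of_nonneg_right hPlo (sub_nonneg.2 hμ₁), mul_le_mul_of_nonneg_right hPhi hμ₀, eμ']

/-- ★★ TILT ROW on a cell: `l₀ + l₁·t ≤ φ(√q_c(ρ, t))` for every `(ρ, t)` of the cell — the per-ρ secant (NODE 98) with its `a`-anchor majorised and its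
`lo`-anchor minorised uniformly in ρ (NODE 95 box brackets), then the affine certificate below that at both t-ends. -/
theorem tilt_row_cell {c ρ₀ ρ₁ a lo hi rA uA rL lL l₀ l₁ : ℝ} (hc : 0 ≤ c) (hc' : c ≤ 3 / 2) (hc2 : c ^ 2 ≤ 2)
    (hρ₀ : 0 ≤ ρ₀) (ha : ρ₁ ≤ a) (halo : a < lo) (hlohi : lo < hi)
    (hT : TiltRowCert c ρ₀ ρ₁ a lo hi rA uA rL lL l₀ l₁)
    {ρ t : ℝ} (hρ : ρ₀ ≤ ρ) (hρ' : ρ ≤ ρ₁) (ht : lo ≤ t) (ht' : t ≤ hi) :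
    l₀ + l₁ * t ≤ depthProfile 160 (Real.sqrt (tiltArg c ρ t)) := by
  obtain ⟨hrA, hrL, hA₀, hA₁, hL₀, hL₁, h64₀, h64₁, hq₀, hq₁, huA, hlL, hElo, hEhi⟩ := hT
  have hqa : 6400 ≤ tiltArg c ρ a := tiltArg_ge_box hc hc' hρ₀ ha h64₀ h64₁ hρ hρ' le_rfl
  have hqhi : tiltArg c ρ hi ≤ 17956 := tiltArg_le_box hc hc' hρ₀ hq₀ hq₁ hρ hρ' (by linarith) le_rfl
  have hsec := tiltWeight_secant_lower hc hc2 (hρ₀.trans hρ) (hρ'.trans ha) hqa hqhi halo hlohi.le t ht ht'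
  have hWa : depthProfile 160 (Real.sqrt (tiltArg c ρ a)) ≤ uA :=
    le_trans (depthProfile_sqrt_le (by norm_num) hrA (tiltArg_le_box hc hc' hρ₀ hA₀ hA₁ hρ hρ' (hρ'.trans ha) le_rfl)) huA
  have hWlo : lL ≤ depthProfile 160 (Real.sqrt (tiltArg c ρ lo)) :=
    le_trans hlL (depthProfile_sqrt_ge (by norm_num) hrL (tiltArg_ge_box hc hc' hρ₀ (ha.trans halo.le) hL₀ hL₁ hρ hρ' le_rfl))
  have hne₁ : lo - a ≠ 0 := (sub_pos.2 halo).ne'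
  have hne₂ : hi - lo ≠ 0 := (sub_pos.2 hlohi).ne'
  -- the secant in two-point form, λ = (t − a)/(lo − a) ≥ 1
  have hlam1 : 1 ≤ (t - a) / (lo - a) := by rw [le_div_iff₀ (sub_pos.2 halo)]; linarith
  have e1 : (depthProfile 160 (Real.sqrt (tiltArg c ρ lo)) - depthProfile 160 (Real.sqrt (tiltArg c ρ a))) / (lo - a) * (t - a) =
      (depthProfile 160 (Real.sqrt (tiltArg c ρ lo)) - depthProfile 160 (Real.sqrt (tiltArg c ρ a))) * ((t - a) / (lo - a)) := by
    rw [div_mul_eq_mul_div, mul_div_assoc]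
  rw [e1] at hsec
  -- anchors replaced: σ(t) = uA(1 − λ) + lL·λ ≤ secant(t)
  have hσ : uA * (1 - (t - a) / (lo - a)) + lL * ((t - a) / (lo - a)) ≤
      depthProfile 160 (Real.sqrt (tiltArg c ρ a)) +
        (depthProfile 160 (Real.sqrt (tiltArg c ρ lo)) - depthProfile 160 (Real.sqrt (tiltArg c ρ a))) * ((t - a) / (lo - a)) := by
    nlinarith [mul_le_mul_of_nonpos_right hWa (by linarith : 1 - (t - a) / (lo - a) ≤ 0),
      mul_le_mul_of_nonneg_right hWlo (by linarith : 0 ≤ (t - a) / (lo - a))]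
  -- the affine certificate below σ on [lo, hi]: convex combination of the two end checks, s = (t − lo)/(hi − lo)
  have hs₀ : 0 ≤ (t - lo) / (hi - lo) := div_nonneg (by linarith) (by linarith)
  have hs₁ : (t - lo) / (hi - lo) ≤ 1 := by rw [div_le_one (by linarith)]; linarith
  have es : (t - lo) / (hi - lo) * (hi - lo) = t - lo := div_mul_cancel₀ _ hne₂
  have elams : (t - a) / (lo - a) = 1 + (t - lo) / (hi - lo) * ((hi - a) / (lo - a) - 1) := by
    field_simp
    ring
  have eL : l₀ + l₁ * t = (1 - (t - lo) / (hi - lo)) * (l₀ + l₁ * lo) + (t - lo) / (hi - lo) * (l₀ + l₁ * hi) := by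
    linear_combination (-l₁) * es
  have eσ : uA * (1 - (t - a) / (lo - a)) + lL * ((t - a) / (lo - a)) =
      (1 - (t - lo) / (hi - lo)) * lL + (t - lo) / (hi - lo) * (uA * (1 - (hi - a) / (lo - a)) + lL * ((hi - a) / (lo - a))) := by
    rw [elams]
    ring
  have p1 := mul_le_mul_of_nonneg_left hElo (sub_nonneg.2 hs₁)
  have p2 := mul_le_mul_of_nonneg_left hEhi hs₀
  calc l₀ + l₁ * t = (1 - (t - lo) / (hi - lo)) * (l₀ + l₁ * lo) + (t - lo) / (hi - lo) * (l₀ + l₁ * hi) := eL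
    _ ≤ (1 - (t - lo) / (hi - lo)) * lL + (t - lo) / (hi - lo) * (uA * (1 - (hi - a) / (lo - a)) + lL * ((hi - a) / (lo - a))) := add_le_add p1 p2
    _ = uA * (1 - (t - a) / (lo - a)) + lL * ((t - a) / (lo - a)) := eσ.symm
    _ ≤ _ := hσ
    _ ≤ _ := hsec

/-! ## §99.4 The cap minorant of a cell -/

/-- ★★★ **CAP SIDE OF A CENSUS CELL (PROVED, generic)**: from the certificates — cell geometry, one pole row, three tilt rows (c = 439/485, 527/485,
483/485), a dual-feasible price vector with the y⋆ sign pattern, its affine cap minorant checked `≥ Bmin ≥ 0` at the four cell corners, and the final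
arithmetic `capLB·u ≤ κ(hi)·(u/10 + 1.03·(0.06ρ₀)²·Bmin)` with `κ(hi) = max 1 (min 2 ((116 − hi)/3)) ≤ κ(t)` — the cap dominates `capLB·u` on the
whole cell. -/
theorem capCell_lower {u ρ₀ ρ₁ a lo hi dlo dhi p₀ p₁ : ℝ}
    {rA₁ uA₁ rL₁ lL₁ l₀₁ l₁₁ rA₂ uA₂ rL₂ lL₂ l₀₂ l₁₂ rA₃ uA₃ rL₃ lL₃ l₀₃ l₁₃ : ℝ}
    {y0T y0F y1T y1F y2T y2F Bmin capLB : ℝ}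
    (hg : CapCellGeom ρ₀ ρ₁ a lo hi dlo dhi) (hP : PoleRowCert dlo dhi p₀ p₁)
    (hT₁ : TiltRowCert (439 / 485) ρ₀ ρ₁ a lo hi rA₁ uA₁ rL₁ lL₁ l₀₁ l₁₁)
    (hT₂ : TiltRowCert (527 / 485) ρ₀ ρ₁ a lo hi rA₂ uA₂ rL₂ lL₂ l₀₂ l₁₂)
    (hT₃ : TiltRowCert (483 / 485) ρ₀ ρ₁ a lo hi rA₃ uA₃ rL₃ lL₃ l₀₃ l₁₃)
    (hy : IsRoofDualFeasible T75 (sext y0T y0F y1T y1F y2T y2F))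
    (hs₀ : y0T + y0F ≤ 0) (hs₁ : 0 ≤ y1T) (hs₂ : 0 ≤ y1F) (hs₃ : 0 ≤ y2T + y2F) (hB : 0 ≤ Bmin)
    (hc₀₀ : Bmin ≤ capMinorant (y0T + y0F) y1T y1F (y2T + y2F) p₀ p₁ l₀₁ l₁₁ l₀₂ l₁₂ l₀₃ l₁₃ lo ρ₀)
    (hc₀₁ : Bmin ≤ capMinorant (y0T + y0F) y1T y1F (y2T + y2F) p₀ p₁ l₀₁ l₁₁ l₀₂ l₁₂ l₀₃ l₁₃ lo ρ₁)
    (hc₁₀ : Bmin ≤ capMinorant (y0T + y0F) y1T y1F (y2T + y2F) p₀ p₁ l₀₁ l₁₁ l₀₂ l₁₂ l₀₃ l₁₃ hi ρ₀)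
    (hc₁₁ : Bmin ≤ capMinorant (y0T + y0F) y1T y1F (y2T + y2F) p₀ p₁ l₀₁ l₁₁ l₀₂ l₁₂ l₀₃ l₁₃ hi ρ₁)
    (hu : 0 ≤ u) (hcap : capLB * u ≤ max 1 (min 2 ((116 - hi) / 3)) * (u / 10 + 103 / 100 * ((3 / 100 * (2 * ρ₀)) ^ 2 * Bmin))) :
    ∀ ρ t : ℝ, ρ₀ ≤ ρ → ρ ≤ ρ₁ → lo ≤ t → t ≤ hi → capLB * u ≤ domCapK u 160 (3 / 100) ρ t := by
  intro ρ t hρ hρ' ht ht'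
  obtain ⟨hρ₀, hρ₀₁, ha, halo, hlohi, hdlo, hdlt, hdhi, hd₀, hd₁⟩ := hg
  have hE6 := domCapK_ge_of_dualFeasible u 160 (3 / 100) ρ t hy
  rw [sum_six] at hE6
  obtain ⟨e0, e1, e2, e3, e4, e5⟩ := sext_apply_six y0T y0F y1T y1F y2T y2F
  rw [e0, e1, e2, e3, e4, e5] at hE6
  obtain ⟨w0, w1, w2, w3, w4, w5⟩ := tiltSext_apply 160 ρ t
  rw [w0, w1, w2, w3, w4, w5] at hE6
  -- the four rows
  have hpole := pole_row_cell hdlo hdlt hdhi hP (t - ρ) (by linarith) (by linarith)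
  have r₁ := tilt_row_cell (by norm_num) (by norm_num) (by norm_num) hρ₀ ha halo hlohi hT₁ hρ hρ' ht ht'
  have r₂ := tilt_row_cell (by norm_num) (by norm_num) (by norm_num) hρ₀ ha halo hlohi hT₂ hρ hρ' ht ht'
  have r₃ := tilt_row_cell (by norm_num) (by norm_num) (by norm_num) hρ₀ ha halo hlohi hT₃ hρ hρ' ht ht'
  have t₀ := mul_le_mul_of_nonpos_left hpole hs₀
  have t₁ := mul_le_mul_of_nonneg_left r₁ hs₁
  have t₂ := mul_le_mul_of_nonneg_left r₂ hs₂
  have t₃ := mul_le_mul_of_nonneg_left r₃ hs₃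
  -- Σ_p y_p w_p ≥ capMinorant(t, ρ) ≥ Bmin (affine on the box ⇒ corners)
  have hSum : capMinorant (y0T + y0F) y1T y1F (y2T + y2F) p₀ p₁ l₀₁ l₁₁ l₀₂ l₁₂ l₀₃ l₁₃ t ρ ≤
      y0T * depthProfile 160 (t - ρ) + y0F * depthProfile 160 (t - ρ) +
      y1T * depthProfile 160 (Real.sqrt (tiltArg (439 / 485) ρ t)) + y1F * depthProfile 160 (Real.sqrt (tiltArg (527 / 485) ρ t)) +
      y2T * depthProfile 160 (Real.sqrt (tiltArg (483 / 485) ρ t)) + y2F * depthProfile 160 (Real.sqrt (tiltArg (483 / 485) ρ t)) := by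
    unfold capMinorant
    linarith [t₀, t₁, t₂, t₃]
  have e : ∀ t' x : ℝ, capMinorant (y0T + y0F) y1T y1F (y2T + y2F) p₀ p₁ l₀₁ l₁₁ l₀₂ l₁₂ l₀₃ l₁₃ t' x =
      ((y0T + y0F) * p₀ + y1T * l₀₁ + y1F * l₀₂ + (y2T + y2F) * l₀₃) + ((y0T + y0F) * p₁ + y1T * l₁₁ + y1F * l₁₂ + (y2T + y2F) * l₁₃) * t' +
        (-((y0T + y0F) * p₁)) * x := by
    intro t' x; unfold capMinorant; ring
  have hmin : Bmin ≤ capMinorant (y0T + y0F) y1T y1F (y2T + y2F) p₀ p₁ l₀₁ l₁₁ l₀₂ l₁₂ l₀₃ l₁₃ t ρ := by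
    rw [e] at hc₀₀ hc₀₁ hc₁₀ hc₁₁ ⊢
    exact affine_ge_on_box hc₀₀ hc₀₁ hc₁₀ hc₁₁ ht ht' hρ hρ'
  have hSum2 := hmin.trans hSum
  -- final arithmetic with the weight sum abstracted: κ(t) ≥ κ(hi) ≥ 1, (0.06ρ)² ≥ (0.06ρ₀)², Σ ≥ Bmin ≥ 0
  generalize hS : (y0T * depthProfile 160 (t - ρ) + y0F * depthProfile 160 (t - ρ) +
      y1T * depthProfile 160 (Real.sqrt (tiltArg (439 / 485) ρ t)) + y1F * depthProfile 160 (Real.sqrt (tiltArg (527 / 485) ρ t)) +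
      y2T * depthProfile 160 (Real.sqrt (tiltArg (483 / 485) ρ t)) + y2F * depthProfile 160 (Real.sqrt (tiltArg (483 / 485) ρ t))) = S at hE6 hSum2
  have hρsq : (3 / 100 * (2 * ρ₀)) ^ 2 ≤ (3 / 100 * (2 * ρ)) ^ 2 := pow_le_pow_left₀ (by linarith) (by linarith) 2
  have hprod := mul_le_mul hρsq hSum2 hB (sq_nonneg _)
  have hB₀ := mul_nonneg (sq_nonneg (3 / 100 * (2 * ρ₀))) hB
  have hX : 0 ≤ u / 10 + 103 / 100 * ((3 / 100 * (2 * ρ)) ^ 2 * S) := by linarith [hprod, hB₀]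
  have hk₀ : (0 : ℝ) ≤ max 1 (min 2 ((116 - hi) / 3)) := le_trans zero_le_one (le_max_left _ _)
  calc capLB * u ≤ max 1 (min 2 ((116 - hi) / 3)) * (u / 10 + 103 / 100 * ((3 / 100 * (2 * ρ₀)) ^ 2 * Bmin)) := hcap
    _ ≤ max 1 (min 2 ((116 - hi) / 3)) * (u / 10 + 103 / 100 * ((3 / 100 * (2 * ρ)) ^ 2 * S)) :=
        mul_le_mul_of_nonneg_left (by linarith [hprod]) hk₀
    _ ≤ domKappa t * (u / 10 + 103 / 100 * ((3 / 100 * (2 * ρ)) ^ 2 * S)) := mul_le_mul_of_nonneg_right (domKappa_ge_hi ht') hX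
    _ = domKappa t * (u / 10) + domKappa t * (103 / 100 * ((3 / 100 * (2 * ρ)) ^ 2 * S)) := by ring
    _ ≤ domCapK u 160 (3 / 100) ρ t := hE6

end Summit.AtomisticToContinuum.Crystallization.Theorems.ChargedEnergyGapChartDial
end
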